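import Mathlib.GroupTheory.Nilpotent
import Mathlib.GroupTheory.QuotientGroup.Basic
import Mathlib.GroupTheory.PresentedGroup
import Mathlib.Tactic.Group
import Literature.GroupTheory.CombinatorialGroupTheory.LowerCentralSeriesLieRing
import Literature.Topology.FourManifolds.SurfaceGroupHomology
import Summits.SmoothPoincare4.SmoothPoincare4.Theorems.CongruenceShadowsNilpotentShadowsStandardJohnsonClassTwo
import HarnessLib

/-!
# BSCC transport I: the `J_k`-calculus (helper for stub `stub_bsccTransport`)

Line `saturated-torsor-descent`, crux `CongruenceShadows.NilpotentShadowsStandard`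
(item stmt-SmoothPoincare4-14594).  General group theory, any group `G`, `γₖ₊₁ = lcs G k =
(⊤ : Subgroup G).lowerCentralSeries k`, automorphisms `T` with `T s · s⁻¹ ∈ γₖ₊₁` for all `s`
("`J_k`"), everything read modulo `γₖ₊₂`:
* elements of `γₖ₊₁` are central modulo `γₖ₊₂` (`quotk_central`), so `s ↦ T s · s⁻¹` is a
  homomorphism modulo `γₖ₊₂` (`jk_quot_mul`) killing `γ₂` (`jk_quot_lcs`: `T ⁅p, q⁆ = ⁅u p, u' q⁆`
  with `u, u'` central), the inverse automorphism has opposite data (`jk_quot_symm`, `k ≥ 1`) and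
  composition adds data (`jk_quot_trans`, `k ≥ 1`); membership forms `jk_*_mem`;
* `J_k` on the letters of a presented group implies `J_k` (`jk_of_letters`);
* the weight congruence `⁅x', y'⁆ ≡ ⁅x, y⁆ (mod γ_{i+j+3})` for `x' ≡ x (mod γ_{i+2})`, `x ∈ γ_{i+1}`,
  `y' ≡ y (mod γ_{j+2})`, `y ∈ γ_{j+1}` (`commutator_congr_mem`, from the tree's symbol calculus
  `toGr_commutator_congr_left/right`), and its weight-3 instance `weightThree_congr`;
* for the surface group `S_n` (`Literature.Topology.FourManifolds.SurfaceGroup`), the exponent-sum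
  expansion `T w · w⁻¹ ≡ ∏_v (T v · v⁻¹)^{e_v(w)} (mod γₖ₊₂)` over the letter list
  `a₀, b₀, a₁, b₁, …` (`jk_expansion`: both sides are homomorphisms `S_n → S_n/γₖ₊₂` agreeing on
  the letters, `PresentedGroup.ext`; `e_v = ` coordinate `v` of `SurfaceGroup.abelianize`).
The same calculus one class lower is `…JohnsonClassTwo` (`ia_quot_*`), whose quotient lemmas are
reused.  Mathlib + `Literature` only; no definitions, no named facts.
-/

set_option linter.dupNamespace false

open Subgroup Literature.GroupTheory.CombinatorialGroupTheory Literature.Topology.FourManifolds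
open scoped commutatorElement

namespace Summit.SmoothPoincare4.SmoothPoincare4.Theorems.NilpotentShadowsStandard.SaturatedTorsorDescent

namespace BsccTransport

variable {G : Type*} [Group G]

/-! ## Central elements modulo the next term -/

/-- Elements of `γₖ₊₁` are central modulo `γₖ₊₂`. [folklore] -/
theorem quotk_central {k : ℕ} {p : G} (hp : p ∈ lcs G k) (q : G ⧸ lcs G (k + 1)) :
    (p : G ⧸ lcs G (k + 1)) * q = q * p := by
  obtain ⟨q, rfl⟩ := QuotientGroup.mk_surjective q
  rw [← commutatorElement_eq_one_iff_mul_comm, ← quot_commutatorElement, QuotientGroup.eq_one_iff]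
  exact commutator_mem_commutator hp (mem_top q)

/-- A commutator is unchanged by central left factors: `⁅u p, w q⁆ = ⁅p, q⁆` for central `u, w`.
[folklore] -/
theorem commutatorElement_central_mul {M : Type*} [Group M] {u w : M} (hu : ∀ x, u * x = x * u)
    (hw : ∀ x, w * x = x * w) (p q : M) : ⁅u * p, w * q⁆ = ⁅p, q⁆ := by
  have h1 : ⁅u, w * q⁆ = 1 := commutatorElement_eq_one_iff_mul_comm.2 (hu _)
  have h2 : ⁅p, w⁆ = 1 := commutatorElement_eq_one_iff_mul_comm.2 (hw _).symm
  have hw' : w * ⁅p, q⁆ * w⁻¹ = ⁅p, q⁆ := by rw [mul_inv_eq_iff_eq_mul]; exact hw _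
  have hu' : u * ⁅p, q⁆ * u⁻¹ = ⁅p, q⁆ := by rw [mul_inv_eq_iff_eq_mul]; exact hu _
  rw [commutatorElement_mul_left_eq_conj_mul, h1, mul_one, commutatorElement_mul_right_eq_mul_conj,
    h2, one_mul, hw', hu']

/-! ## The `J_k`-calculus modulo `γₖ₊₂` -/

section Jk

variable {k : ℕ} {T : G ≃* G}

/-- The datum of a `J_k`-automorphism takes central values modulo `γₖ₊₂`. [folklore] -/
theorem jk_quot_central (hT : ∀ s, T s * s⁻¹ ∈ lcs G k) (s : G) (q : G ⧸ lcs G (k + 1)) :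
    ((T s * s⁻¹ : G) : G ⧸ lcs G (k + 1)) * q = q * (T s * s⁻¹ : G) :=
  quotk_central (hT s) q

/-- **Additivity**: `T(xy)(xy)⁻¹ ≡ (T x x⁻¹)(T y y⁻¹) (mod γₖ₊₂)`. [folklore] -/
theorem jk_quot_mul (hT : ∀ s, T s * s⁻¹ ∈ lcs G k) (x y : G) :
    ((T (x * y) * (x * y)⁻¹ : G) : G ⧸ lcs G (k + 1)) =
      ((T x * x⁻¹ : G) : G ⧸ lcs G (k + 1)) * (T y * y⁻¹ : G) := by
  have e : T (x * y) * (x * y)⁻¹ = (T x * x⁻¹) * (x * (T y * y⁻¹) * x⁻¹) := by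
    simp only [map_mul]; group
  rw [e, QuotientGroup.mk_mul _ (T x * x⁻¹), QuotientGroup.mk_mul _ (x * _), QuotientGroup.mk_mul _ x,
    ← jk_quot_central hT y, QuotientGroup.mk_inv, mul_inv_cancel_right]

/-- The datum of `1` is trivial. [folklore] -/
theorem jk_quot_one (T : G ≃* G) : ((T 1 * 1⁻¹ : G) : G ⧸ lcs G (k + 1)) = 1 := by
  rw [map_one, inv_one, mul_one, QuotientGroup.mk_one]

/-- The datum of an inverse: `T(x⁻¹) x ≡ (T x x⁻¹)⁻¹`. [folklore] -/
theorem jk_quot_inv (hT : ∀ s, T s * s⁻¹ ∈ lcs G k) (x : G) :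
    ((T x⁻¹ * x⁻¹⁻¹ : G) : G ⧸ lcs G (k + 1)) = ((T x * x⁻¹ : G) : G ⧸ lcs G (k + 1))⁻¹ := by
  have h := jk_quot_mul hT x x⁻¹
  rw [mul_inv_cancel, jk_quot_one] at h
  exact eq_inv_of_mul_eq_one_right h.symm

/-- **`J_k` acts trivially on `γ₂` modulo `γₖ₊₂`**: `T l · l⁻¹ ∈ γₖ₊₂` for `l ∈ γ₂`
(`T ⁅p, q⁆ = ⁅u p, u' q⁆` with `u, u'` central modulo `γₖ₊₂`). [folklore] -/
theorem jk_quot_lcs (hT : ∀ s, T s * s⁻¹ ∈ lcs G k) {l : G} (hl : l ∈ lcs G 1) :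
    ((T l * l⁻¹ : G) : G ⧸ lcs G (k + 1)) = 1 := by
  have key : ∀ p : G, ((T p : G) : G ⧸ lcs G (k + 1)) =
      ((T p * p⁻¹ : G) : G ⧸ lcs G (k + 1)) * p := fun p => by
    rw [← QuotientGroup.mk_mul, inv_mul_cancel_right]
  rw [QuotientGroup.mk_mul, QuotientGroup.mk_inv, mul_inv_eq_one]
  have hl' : l ∈ closure {g : G | ∃ p ∈ lcs G 0, ∃ q ∈ (⊤ : Subgroup G), ⁅p, q⁆ = g} := hl
  clear hl
  induction hl' using Subgroup.closure_induction with
  | mem g hg =>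
    obtain ⟨p, -, q, -, rfl⟩ := hg
    rw [map_commutatorElement, quot_commutatorElement, quot_commutatorElement, key p, key q]
    exact commutatorElement_central_mul (jk_quot_central hT p) (jk_quot_central hT q) _ _
  | one => simp
  | mul a b _ _ iha ihb => rw [map_mul, QuotientGroup.mk_mul, QuotientGroup.mk_mul, iha, ihb]
  | inv a _ ih => rw [map_inv, QuotientGroup.mk_inv, QuotientGroup.mk_inv, ih]

/-- For `k ≥ 1`, `J_k ⊆ IA`: the data lie in `γ₂`. [folklore] -/
theorem jk_mem_lcs_one (hk : 1 ≤ k) (hT : ∀ s, T s * s⁻¹ ∈ lcs G k) (s : G) : T s * s⁻¹ ∈ lcs G 1 :=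
  lcs_antitone hk (hT s)

/-- The datum of the inverse automorphism: `T⁻¹ x · x⁻¹ ≡ (T x x⁻¹)⁻¹ (mod γₖ₊₂)` (`k ≥ 1`).
[folklore] -/
theorem jk_quot_symm (hk : 1 ≤ k) (hT : ∀ s, T s * s⁻¹ ∈ lcs G k) (x : G) :
    ((T.symm x * x⁻¹ : G) : G ⧸ lcs G (k + 1)) = ((T x * x⁻¹ : G) : G ⧸ lcs G (k + 1))⁻¹ := by
  have e1 : T.symm x * x⁻¹ = (T (T.symm x) * (T.symm x)⁻¹)⁻¹ := by simp
  have hy : T.symm x = (T.symm x * x⁻¹) * x := by simp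
  have hmem : T.symm x * x⁻¹ ∈ lcs G 1 := by
    have h1 := inv_mem (jk_mem_lcs_one hk hT (T.symm x))
    rw [MulEquiv.apply_symm_apply] at h1
    simpa using h1
  rw [e1, QuotientGroup.mk_inv]
  congr 1
  conv_lhs => rw [hy]
  rw [jk_quot_mul hT, jk_quot_lcs hT hmem, one_mul]

/-- The datum of a composite: `T (T' x) · x⁻¹ ≡ (T x x⁻¹)(T' x x⁻¹) (mod γₖ₊₂)` (`k ≥ 1`).
[folklore] -/
theorem jk_quot_trans (hk : 1 ≤ k) (hT : ∀ s, T s * s⁻¹ ∈ lcs G k) {T' : G ≃* G}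
    (hT' : ∀ s, T' s * s⁻¹ ∈ lcs G k) (x : G) :
    ((T (T' x) * x⁻¹ : G) : G ⧸ lcs G (k + 1)) =
      ((T x * x⁻¹ : G) : G ⧸ lcs G (k + 1)) * (T' x * x⁻¹ : G) := by
  have e : T (T' x) * x⁻¹ = (T (T' x * x⁻¹) * (T' x * x⁻¹)⁻¹) *
      ((T' x * x⁻¹) * (T x * x⁻¹) * (T' x * x⁻¹)⁻¹) * (T' x * x⁻¹) := by
    simp only [map_mul, map_inv]; group
  rw [e, QuotientGroup.mk_mul, QuotientGroup.mk_mul, jk_quot_lcs hT (jk_mem_lcs_one hk hT' x), one_mul,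
    QuotientGroup.mk_mul, QuotientGroup.mk_mul, jk_quot_central hT' x, QuotientGroup.mk_inv,
    inv_mul_cancel_right, ← jk_quot_central hT' x]

/-! ### Membership forms -/

/-- Additivity of the datum, as a membership. [folklore] -/
theorem jk_mul_mem (hT : ∀ s, T s * s⁻¹ ∈ lcs G k) (s t : G) :
    T (s * t) * (s * t)⁻¹ * ((T s * s⁻¹) * (T t * t⁻¹))⁻¹ ∈ lcs G (k + 1) := by
  rw [mul_inv_mem_iff_quot, QuotientGroup.mk_mul]
  exact jk_quot_mul hT s t

/-- The inverse automorphism has opposite datum, as a membership (`k ≥ 1`). [folklore] -/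
theorem jk_symm_mem (hk : 1 ≤ k) (hT : ∀ s, T s * s⁻¹ ∈ lcs G k) (s : G) :
    T.symm s * s⁻¹ * (T s * s⁻¹) ∈ lcs G (k + 1) := by
  rw [← QuotientGroup.eq_one_iff, QuotientGroup.mk_mul, jk_quot_symm hk hT, inv_mul_eq_one]

/-- `J_k` is trivial on `γ₂` modulo `γₖ₊₂`, as a membership. [folklore] -/
theorem jk_lcs_mem (hT : ∀ s, T s * s⁻¹ ∈ lcs G k) {z : G} (hz : z ∈ lcs G 1) :
    T z * z⁻¹ ∈ lcs G (k + 1) := by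
  rw [← QuotientGroup.eq_one_iff]
  exact jk_quot_lcs hT hz

/-- Composition adds data, as a membership (`k ≥ 1`). [folklore] -/
theorem jk_trans_mem (hk : 1 ≤ k) (hT : ∀ s, T s * s⁻¹ ∈ lcs G k) {T' : G ≃* G}
    (hT' : ∀ s, T' s * s⁻¹ ∈ lcs G k) (s : G) :
    T (T' s) * s⁻¹ * ((T s * s⁻¹) * (T' s * s⁻¹))⁻¹ ∈ lcs G (k + 1) := by
  rw [mul_inv_mem_iff_quot, QuotientGroup.mk_mul]
  exact jk_quot_trans hk hT hT' s

end Jk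

/-! ## `J_k` on letters implies `J_k` -/

/-- If an automorphism of a presented group moves every letter within its `γₖ₊₁`-coset, it moves
every element within its `γₖ₊₁`-coset (the moved-within set is a subgroup). [folklore] -/
theorem jk_of_letters {α : Type*} {rels : Set (FreeGroup α)} {k : ℕ}
    (T : PresentedGroup rels ≃* PresentedGroup rels)
    (h : ∀ v : α, T (PresentedGroup.of v) * (PresentedGroup.of v)⁻¹ ∈ lcs (PresentedGroup rels) k)
    (s : PresentedGroup rels) : T s * s⁻¹ ∈ lcs (PresentedGroup rels) k := by
  refine PresentedGroup.generated_by rels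
    { carrier := {s | T s * s⁻¹ ∈ lcs (PresentedGroup rels) k}
      mul_mem' := fun {x y} hx hy => ?_
      one_mem' := by simp
      inv_mem' := fun {x} hx => ?_ } h s
  · have e : T (x * y) * (x * y)⁻¹ = (T x * x⁻¹) * (x * (T y * y⁻¹) * x⁻¹) := by
      simp only [map_mul]; group
    show T (x * y) * (x * y)⁻¹ ∈ lcs (PresentedGroup rels) k
    rw [e]
    exact mul_mem hx (conj_mem_lcs x hy)
  · have e : T x⁻¹ * x⁻¹⁻¹ = x⁻¹ * (T x * x⁻¹)⁻¹ * x⁻¹⁻¹ := by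
      simp only [map_inv]; group
    show T x⁻¹ * x⁻¹⁻¹ ∈ lcs (PresentedGroup rels) k
    rw [e]
    exact conj_mem_lcs x⁻¹ (inv_mem hx)

/-! ## The weight congruence for commutators -/

/-- **Bracket congruence on the graded pieces**: if `x ∈ γ_{i+1}`, `x' x⁻¹ ∈ γ_{i+2}`,
`y ∈ γ_{j+1}`, `y' y⁻¹ ∈ γ_{j+2}`, then `⁅x', y'⁆ ⁅x, y⁆⁻¹ ∈ γ_{i+j+3}` (`= lcs (i + j + 2)`).
[folklore] -/
theorem commutator_congr_mem {i j N : ℕ} (hN : i + j + 2 = N) {x x' y y' : G} (hx : x ∈ lcs G i)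
    (hx' : x' * x⁻¹ ∈ lcs G (i + 1)) (hy : y ∈ lcs G j) (hy' : y' * y⁻¹ ∈ lcs G (j + 1)) :
    ⁅x', y'⁆ * ⁅x, y⁆⁻¹ ∈ lcs G N := by
  have hs : x⁻¹ * x' ∈ lcs G (i + 1) := by simpa [mul_assoc] using conj_mem_lcs x⁻¹ hx'
  have ht : y⁻¹ * y' ∈ lcs G (j + 1) := by simpa [mul_assoc] using conj_mem_lcs y⁻¹ hy'
  have ex : x' = x * (x⁻¹ * x') := by group
  have ey : y' = y * (y⁻¹ * y') := by group
  have hy'' : y' ∈ lcs G j := by rw [ey]; exact mul_mem hy (lcs_succ_le j ht)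
  have hx'' : x' ∈ lcs G i := by rw [ex]; exact mul_mem hx (lcs_succ_le i hs)
  have h1 : toGr G (i + j + 1) ⁅x', y'⁆ = toGr G (i + j + 1) ⁅x, y⁆ := by
    conv_lhs => rw [ex, toGr_commutator_congr_left rfl hx hs hy'', ey,
      toGr_commutator_congr_right rfl hx hy ht]
  have h2 := (toGr_eq_toGr_iff (commutator_mem_lcs hx'' hy'') (commutator_mem_lcs hx hy)).1 h1
  have e : ⁅x', y'⁆ * ⁅x, y⁆⁻¹ = ⁅x', y'⁆ * (⁅x', y'⁆⁻¹ * ⁅x, y⁆)⁻¹ * ⁅x', y'⁆⁻¹ := by group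
  rw [e, ← hN]
  exact conj_mem_lcs _ (inv_mem h2)

/-- **Weight-3 congruence**: `⁅⁅e', f'⁆, e'⁆ ≡ ⁅⁅e, f⁆, e⁆` and `⁅⁅e', f'⁆, f'⁆ ≡ ⁅⁅e, f⁆, f⁆`
modulo `γ₄` whenever `e' ≡ e`, `f' ≡ f` modulo `γ₂`. [folklore] -/
theorem weightThree_congr (e e' f f' : G) (he : e' * e⁻¹ ∈ lcs G 1) (hf : f' * f⁻¹ ∈ lcs G 1) :
    ⁅⁅e', f'⁆, e'⁆ * (⁅⁅e, f⁆, e⁆)⁻¹ ∈ lcs G 3 ∧ ⁅⁅e', f'⁆, f'⁆ * (⁅⁅e, f⁆, f⁆)⁻¹ ∈ lcs G 3 := by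
  have h0 : ∀ z : G, z ∈ lcs G 0 := fun z => mem_top z
  have hc : ⁅e', f'⁆ * ⁅e, f⁆⁻¹ ∈ lcs G 2 :=
    commutator_congr_mem (i := 0) (j := 0) (N := 2) rfl (h0 e) he (h0 f) hf
  have hef : ⁅e, f⁆ ∈ lcs G 1 := commutator_mem_lcs_of_eq (N := 1) rfl (h0 e) (h0 f)
  exact ⟨commutator_congr_mem (i := 1) (j := 0) (N := 3) rfl hef hc (h0 e) he,
    commutator_congr_mem (i := 1) (j := 0) (N := 3) rfl hef hc (h0 f) hf⟩

/-! ## The exponent-sum expansion of the datum in the surface group -/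

/-- A list product of products `f i * g i` splits when the `f i` are central. [folklore] -/
theorem prod_map_mul_central {M ι : Type*} [Monoid M] (f g : ι → M) (hf : ∀ i x, f i * x = x * f i) :
    ∀ l : List ι, (l.map fun i => f i * g i).prod = (l.map f).prod * (l.map g).prod
  | [] => by simp
  | a :: l => by
    have hc : (l.map f).prod * g a = g a * (l.map f).prod :=
      (Commute.list_prod_right (l.map f) (g a) fun x hx => by
        obtain ⟨i, -, rfl⟩ := List.mem_map.1 hx
        exact (hf i (g a)).symm).symm
    simp only [List.map_cons, List.prod_cons, prod_map_mul_central f g hf l]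
    rw [mul_assoc, mul_assoc, ← mul_assoc (g a), ← hc, mul_assoc]

/-- The letter list `a₀, b₀, a₁, b₁, …` of `S_n` has no duplicates. [folklore] -/
theorem letters_nodup (n : ℕ) : ((List.finRange n).flatMap fun h => [(h, false), (h, true)]).Nodup := by
  refine List.nodup_flatMap.2 ⟨fun h _ => by simp, ?_⟩
  refine (List.nodup_finRange n).pairwise_of_forall_ne fun a _ b _ hab => ?_
  have hba : b ≠ a := fun h => hab h.symm
  simp [Function.onFun, hba]

/-- Every letter occurs in the letter list. [folklore] -/
theorem mem_letters {n : ℕ} (v : surfaceGen n) :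
    v ∈ (List.finRange n).flatMap fun h => [(h, false), (h, true)] := by
  obtain ⟨i, s⟩ := v
  exact List.mem_flatMap.2 ⟨i, List.mem_finRange i, by cases s <;> simp⟩

/-- **Exponent-sum expansion** of the datum of a `J_k`-automorphism of `S_n`: modulo `γₖ₊₂`,
`T w · w⁻¹ ≡ ∏_v (T v · v⁻¹)^{e_v(w)}` over the letters `v`, `e_v(w)` the exponent sum of `v` in
`w` (both sides are homomorphisms `S_n → S_n/γₖ₊₂` with central values agreeing on letters).
[folklore] -/
theorem jk_expansion {n k : ℕ} {T : SurfaceGroup n ≃* SurfaceGroup n}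
    (hT : ∀ s, T s * s⁻¹ ∈ lcs (SurfaceGroup n) k) (w : SurfaceGroup n) :
    T w * w⁻¹ * ((((List.finRange n).flatMap fun h => [(h, false), (h, true)]).map fun v =>
      (T (PresentedGroup.of v) * (PresentedGroup.of v)⁻¹) ^
        (Multiplicative.toAdd (SurfaceGroup.abelianize n w) v)).prod)⁻¹ ∈
      lcs (SurfaceGroup n) (k + 1) := by
  set L := (List.finRange n).flatMap fun h => [(h, false), (h, true)] with hL
  obtain ⟨τ, hτ⟩ : ∃ τ : SurfaceGroup n →* SurfaceGroup n ⧸ lcs (SurfaceGroup n) (k + 1),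
      ∀ s, τ s = ((T s * s⁻¹ : SurfaceGroup n) : SurfaceGroup n ⧸ lcs (SurfaceGroup n) (k + 1)) :=
    ⟨MonoidHom.mk' _ (jk_quot_mul hT), fun s => rfl⟩
  have hcomm : ∀ (v : surfaceGen n) (x : SurfaceGroup n ⧸ lcs (SurfaceGroup n) (k + 1)),
      τ (PresentedGroup.of v) * x = x * τ (PresentedGroup.of v) := fun v x => by
    rw [hτ]; exact jk_quot_central hT _ x
  obtain ⟨F, hF⟩ : ∃ F : SurfaceGroup n →* SurfaceGroup n ⧸ lcs (SurfaceGroup n) (k + 1),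
      ∀ w, F w = (L.map fun v => τ (PresentedGroup.of v) ^
        (Multiplicative.toAdd (SurfaceGroup.abelianize n w) v)).prod :=
    ⟨MonoidHom.mk' _ fun w w' => by
      simp only [map_mul, toAdd_mul, Pi.add_apply, zpow_add]
      exact prod_map_mul_central (fun v => τ (PresentedGroup.of v) ^ _) _
        (fun v x => (show Commute (τ (PresentedGroup.of v)) x from hcomm v x).zpow_left _) L,
      fun w => rfl⟩
  have hτF : τ = F := PresentedGroup.ext fun v => by
    have hcount : @List.count _ instBEqOfDecidableEq v L = 1 :=
      @List.count_eq_one_of_mem _ instBEqOfDecidableEq _ v L (letters_nodup n) (mem_letters v)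
    rw [hF, SurfaceGroup.abelianize_of, toAdd_ofAdd,
      List.prod_map_eq_pow_single v _ (fun v' hv' _ => by rw [Pi.single_eq_of_ne hv', zpow_zero]),
      hcount, pow_one, Pi.single_eq_same, zpow_one]
  rw [mul_inv_mem_iff_quot, ← hτ, hτF, hF]
  simp only [hτ]
  change _ = QuotientGroup.mk' _ (List.prod _)
  rw [map_list_prod, List.map_map]
  rfl

end BsccTransport

open BsccTransport in
/-- **Registered helper** (`J_k`-calculus of the surface group, every level `k`): for an automorphism `T` of `S_n` with `T s · s⁻¹ ∈ γₖ₊₁` for all `s`, modulo `γₖ₊₂` the datum `s ↦ T s · s⁻¹` is additive, kills `γ₂`, expands by exponent sums over the letters, and (for `k ≥ 1`) is negated by inversion and added by composition. [folklore] -/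
theorem helper_bsccJkExpansion : ∀ (n k : ℕ) (T : Literature.Topology.FourManifolds.SurfaceGroup n ≃* Literature.Topology.FourManifolds.SurfaceGroup n), (∀ s : Literature.Topology.FourManifolds.SurfaceGroup n, T s * s⁻¹ ∈ (⊤ : Subgroup (Literature.Topology.FourManifolds.SurfaceGroup n)).lowerCentralSeries k) → (∀ s t : Literature.Topology.FourManifolds.SurfaceGroup n, T (s * t) * (s * t)⁻¹ * ((T s * s⁻¹) * (T t * t⁻¹))⁻¹ ∈ (⊤ : Subgroup (Literature.Topology.FourManifolds.SurfaceGroup n)).lowerCentralSeries (k + 1)) ∧ (∀ z ∈ (⊤ : Subgroup (Literature.Topology.FourManifolds.SurfaceGroup n)).lowerCentralSeries 1, T z * z⁻¹ ∈ (⊤ : Subgroup (Literature.Topology.FourManifolds.SurfaceGroup n)).lowerCentralSeries (k + 1)) ∧ (∀ w : Literature.Topology.FourManifolds.SurfaceGroup n, T w * w⁻¹ * ((((List.finRange n).flatMap fun h => [(h, false), (h, true)]).map fun v => (T (PresentedGroup.of v) * (PresentedGroup.of v)⁻¹) ^ (Multiplicative.toAdd (Literature.Topology.FourManifolds.SurfaceGroup.abelianize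 n w) v)).prod)⁻¹ ∈ (⊤ : Subgroup (Literature.Topology.FourManifolds.SurfaceGroup n)).lowerCentralSeries (k + 1)) ∧ (1 ≤ k → (∀ s : Literature.Topology.FourManifolds.SurfaceGroup n, T.symm s * s⁻¹ * (T s * s⁻¹) ∈ (⊤ : Subgroup (Literature.Topology.FourManifolds.SurfaceGroup n)).lowerCentralSeries (k + 1)) ∧ ∀ T' : Literature.Topology.FourManifolds.SurfaceGroup n ≃* Literature.Topology.FourManifolds.SurfaceGroup n, (∀ s : Literature.Topology.FourManifolds.SurfaceGroup n, T' s * s⁻¹ ∈ (⊤ : Subgroup (Literature.Topology.FourManifolds.SurfaceGroup n)).lowerCentralSeries k) → ∀ s : Literature.Topology.FourManifolds.SurfaceGroup n, T (T' s) * s⁻¹ * ((T s * s⁻¹) * (T' s * s⁻¹))⁻¹ ∈ (⊤ : Subgroup (Literature.Topology.FourManifolds.SurfaceGroup n)).lowerCentralSeries (k + 1)) := by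
  intro n k T hT
  refine ⟨fun s t => jk_mul_mem hT s t, fun z hz => jk_lcs_mem hT hz, fun w => jk_expansion hT w,
    fun hk => ⟨fun s => jk_symm_mem hk hT s, fun T' hT' s => jk_trans_mem hk hT hT' s⟩⟩

end Summit.SmoothPoincare4.SmoothPoincare4.Theorems.NilpotentShadowsStandard.SaturatedTorsorDescent
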